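import Summits.QuantumFields.YangMills.Theorems.UnitScaleTiltProp7BlockLandauDivFlat
import Literature.MathematicalPhysics.QuantumFieldTheory.Balaban1983to89.B5Adjoint176
import HarnessLib

/-!
# Route `UnitScaleTilt`, crux K1 «MinimiserStabilityRegPr» (stmt-QuantumFields-19200), route-R E′ growth side, S3 K-form engine, row R1-SLOW ∕ hKg-K at the
# R2-CRITICAL background — THE ALIAS LEMMA ONE POWER DOWN («Bernstein for the curl-minimal interpolant», flat, leading order):
# `Σ_l W_l∕Δ(p′+l) ≤ C_B·Σ_l W_l∕Δ(p′+l)²` at every reduced momentum `p′ ≠ 0`, for alias weights dominated by the block-mean leaves, `C_B` ABSOLUTE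

Cell `ym3-torus`, width seat `ym-ust-19200-w4` (gen 7); ★★OWNER g28 ACK 84 (1) «w4 g7: (B1) LOCATE∕typing at own risk … welcome» (2026-08-28 22:36Z) on this seat's
`LOCATE-RB-HKGK-MECHANISM-w4g7.md` (law `C_g(0⁺;W) = sup_V‖curl Π_σY‖²∕‖curl Y‖²`, `C_g ≤ ℛ(W)∕κ`) and `LOCATE-B1-BERNSTEIN-w4g7.md` (item (C4)).  THEOREMS ONLY
(0 `def`, 0 `sorry`); `--supports stmt-QuantumFields-19200`, count-neutral.  YM₃ on T³ is a ladder rung (R3), not the Clay problem; nothing here claims S3, E′, a stub, the crux,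
d = 4 or the mass gap.

WHY.  At an R2-critical background the leading-order gauge potential is the curl-minimal interpolant `u = Δ⁻¹Sᵀν` of its coarse data (`Sᵀ` = the STRAIGHT box–box–tent adjoint of
the symmetric average on a coarse-co-closed multiplier `ν`; the stairs drop, the k-fold adjoint telescopes to block `ℓ = L^k` — LOCATE-B1 §0.1–0.3).  The engine's displayed row
hKg-K needs `ℛ = ℓ²‖∇u‖²∕‖u‖² ≤ C_B`, i.e. in momentum, fibre by fibre over the aliases `l` of a reduced momentum `p′ ≠ 0`, `Σ_l W_l∕Δ_l ≤ C_B Σ_l W_l∕Δ_l²` with `W_l =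
|u(p′+l)|²·|u_μ-factor|²` — the SAME four leaves as ✓ `Prop7BlockLandauDivFlat.alias_sum_sq_le` ([Balaban1984PropagatorsI] (1.31)–(1.36): `Σ_l|u|² = 1`, `Δ(p′+l) ≥ 4` for
`l ≠ 0`, `|u(p′)|² ≥ (4∕π²)^d`, `Δ(p′) ≤ dπ²`, η-units), ONE POWER OF `Δ` DOWN.  This file proves that inequality (abstract weights, then the box–box–tent weights), the
fibre-to-torus wrapper, and — since the tree already holds the momentum representation of Bałaban's STRAIGHT vector average (✓ `B5Adjoint176.dft_QvOp_adjoint`,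
(C3) of LOCATE-B1) — the Bernstein inequality itself for `((Q_k)ᴴB)_κ`; the dictionary to the T3 family's symmetric (0.4) average (`S = n·Q_k` up to a translation,
`Q = S − δ∘St`, (C2)) and the finite-`e` perturbation ((C7)) are separate files.

WHAT IS PROVED (ns `…Theorems.Prop7AliasSumBernstein`; any `d`, block side `n ≥ 1`; `B4Strip`∕`B5Prop11Leaves` letters `Ur`, `uFactorr`, `DeltaXir`, `shiftr`).
* §1 ★★ `alias_sum_le_of_weights` — for weights `0 ≤ W_l ≤ Ur_l` (`l ≠ 0`) and `W_0 ≥ w₀ > 0`:  `Σ_l W_l∕Δ_l ≤ (dπ² + (dπ²)²∕(4w₀))·Σ_l W_l∕Δ_l²`  (`p′ ≠ 0`, `|p′_μ| ≤ π`).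
* §2 ★★★ `alias_sum_tent_le` — the box–box–tent weights `W_l = Ur_l·uFactorr(l_μ)` (one extra 1-D leaf in the averaging direction `μ`):
  `Σ_l W_l∕Δ_l ≤ (dπ² + (π²∕4)^{d+1}(dπ²)²∕4)·Σ_l W_l∕Δ_l²`;  `alias_sum_mean_le` — the plain block-mean weights `W_l = Ur_l`: constant `dπ² + (π²∕4)^d(dπ²)²∕4`.
* §3 ★ `sum_div_lsym_le_of_fibrewise` — fibre-to-torus: a non-negative momentum density `g` on `Tor (fine n M)` vanishing on the fibre of `p′ = 0` and obeying the fibrewise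
  inequality with constant `C` obeys `Σ_p g(p)∕Δ(p) ≤ C·Σ_p g(p)∕Δ(p)²` (`Δ = lsym (fine n M) n`); ★★ `sum_div_lsym_le_of_tent_fibres` — the same for densities that are, on each
  fibre `p′ ≠ 0`, a non-negative multiple of the box–box–tent weights: constant `dπ² + (π²∕4)^{d+1}(dπ²)²∕4` (d = 3: `< 8.2·10³`; crude, ABSOLUTE — no `L`, `k`, volume).
* §4 ★★★ `bernstein_QvOp_adjoint` ∕ `bernstein_QvOp_adjoint_pos` — THE FLAT BERNSTEIN INEQUALITY ITSELF for Bałaban's straight vector average `Q_k = B5Block118.QvOp` of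
  (1.18) (= the straight part `S` of the symmetric average up to the factor `n` and a translation): for `f = ((Q_k)ᴴB)_κ`, `Σ_yB(y,κ) = 0`:  `Σ_p|f̂|²∕Δ ≤ C_B·Σ_p|f̂|²∕Δ²`, i.e.
  `re⟪f, Δ⁻¹f⟫ ≤ C_B·‖Δ⁻¹f‖²` (η-units) — in lattice units `‖∇(Δ⁻¹f)‖² ≤ C_B·n⁻²·‖Δ⁻¹f‖²` (✓ `B5Adjoint176.dft_QvOp_adjoint`, ✓ `norm_uSym_sq`∕`norm_vSym_sq`, §3).
HONEST SCOPE.  Trigonometric-sum inequalities and their sum over fibres; in lattice units §3 reads `⟪f, Δ⁻¹f⟫ ≤ C_B ℓ⁻² ⟪f, Δ⁻²f⟫` for any `f` whose DFT has the stated fibre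
structure (§4 gives it for Bałaban's straight `Q_k`; the symmetric average's `S = n·Q_k` up to translation is (C2)'s dictionary).  Nothing of S3, hKg-K, E′ or the crux is claimed; the constant is not sharp (numerically O(1–10) expected).

References: T. Bałaban, CMP 95 (1984) 17–40 [Balaban1984PropagatorsI] ((1.31)–(1.36) pp.23–24); CMP 102 (1985) 277–309 [Balaban1985Variational] ((0.4) p.278, Prop. 7 p.299).
-/

set_option autoImplicit false

noncomputable section

open scoped BigOperators Matrix ComplexConjugate
open Finset

namespace Summit.QuantumFields.YangMills.Theorems.Prop7AliasSumBernstein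

open Literature.MathematicalPhysics.QuantumFieldTheory.Balaban1983to89
open B4Strip B5Prop11Fiber B5Prop11Leaves B5Prop11Plancherel B5Action121 B5Block118 B5LaplaceInverse B5LaplaceSpectral
open B5Momentum130 B5Momentum133 B5Eq135Momentum

variable {d : ℕ} (n : ℕ) [NeZero n]

/-! ## §1 The abstract weighted alias inequality, one power of `Δ` down -/

/-- ★★ **WEIGHTED ALIAS INEQUALITY, ONE POWER DOWN**: at a reduced momentum `p′ = s ≠ 0` with `|s_μ| ≤ π`, for alias weights `W_l ≥ 0` dominated off the principal alias by
the block-mean leaves (`W_l ≤ |u(p′+l)|²` for `l ≠ 0`) and bounded below on it (`W_0 ≥ w₀ > 0`):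
`Σ_l W_l∕Δ(p′+l) ≤ (dπ² + (dπ²)²∕(4w₀))·Σ_l W_l∕Δ(p′+l)²` (η-units: `Δ(p′) ≤ dπ²`, `Δ(p′+l) ≥ 4` for `l ≠ 0`, `Σ_{l≠0}|u(p′+l)|² ≤ 1`).
[cite: Balaban1984PropagatorsI, (1.31)-(1.36) pp.23-24] -/
theorem alias_sum_le_of_weights (hn : 1 ≤ n) (s : Fin d → ℝ) (hs : ∀ μ, |s μ| ≤ Real.pi) (hs0 : s ≠ 0)
    (W : (Fin d → Fin n) → ℝ) (hW0 : ∀ k, 0 ≤ W k) (hWle : ∀ k, k ≠ (fun _ => (0 : Fin n)) → W k ≤ Ur n k s)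
    {w₀ : ℝ} (hw₀ : 0 < w₀) (hW₀ : w₀ ≤ W (fun _ => (0 : Fin n))) :
    ∑ k : Fin d → Fin n, W k / DeltaXir n 0 (shiftr n k s)
      ≤ (d * Real.pi ^ 2 + (d * Real.pi ^ 2) ^ 2 / (4 * w₀))
          * ∑ k : Fin d → Fin n, W k / DeltaXir n 0 (shiftr n k s) ^ 2 := by
  set k0 : Fin d → Fin n := fun _ => (0 : Fin n) with hk0
  obtain ⟨μ0, hμ0⟩ : ∃ μ, s μ ≠ 0 := Function.ne_iff.mp hs0
  have hpi : 0 < Real.pi := Real.pi_pos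
  have hD0 : DeltaXir n 0 (shiftr n k0 s) = DeltaXir n 0 s := by rw [hk0, shiftr_zero]
  have hD0pos : 0 < DeltaXir n 0 s := DeltaXir_pos n hn s hs μ0 hμ0
  have hD0le : DeltaXir n 0 s ≤ d * Real.pi ^ 2 := by
    unfold DeltaXir
    rw [add_zero]
    calc ∑ μ, Sxir n (s μ) ≤ ∑ _μ : Fin d, Real.pi ^ 2 := Finset.sum_le_sum fun μ _ =>
            (Sxir_le n (s μ)).trans (by have := hs μ; nlinarith [abs_le.mp this, sq_abs (s μ)])
      _ = d * Real.pi ^ 2 := by rw [Finset.sum_const, Finset.card_univ, Fintype.card_fin, nsmul_eq_mul]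
  have hdpos : 0 < (d : ℝ) * Real.pi ^ 2 := lt_of_lt_of_le hD0pos hD0le
  have hUnn : ∀ k, 0 ≤ Ur n k s := fun k => Ur_nonneg n k s
  have hDnn : ∀ k, 0 ≤ DeltaXir n 0 (shiftr n k s) := fun k => DeltaXir_nonneg n 0 le_rfl _
  have hDk : ∀ k, k ≠ k0 → 4 ≤ DeltaXir n 0 (shiftr n k s) := fun k hk => DeltaXir_shift_ge_four n k hk s hs
  have hS0 : ∑ k ∈ univ.erase k0, Ur n k s ≤ 1 := S0_le_one n hn s hs
  -- the principal-alias term of the right-hand side controls everything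
  set T : ℝ := W k0 / DeltaXir n 0 s ^ 2 with hT
  have hTge : w₀ / (d * Real.pi ^ 2) ^ 2 ≤ T := by
    rw [hT]
    exact div_le_div₀ (hW0 k0) hW₀ (pow_pos hD0pos 2) (pow_le_pow_left₀ hD0pos.le hD0le 2)
  -- (i) the principal alias on the left
  have h0 : W k0 / DeltaXir n 0 (shiftr n k0 s) ≤ d * Real.pi ^ 2 * T := by
    rw [hD0, hT]
    have e : W k0 / DeltaXir n 0 s = DeltaXir n 0 s * (W k0 / DeltaXir n 0 s ^ 2) := by
      field_simp
    rw [e]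
    exact mul_le_mul_of_nonneg_right hD0le (div_nonneg (hW0 _) (pow_nonneg hD0pos.le 2))
  -- (ii) the aliases `l ≠ 0`
  have h1 : ∑ k ∈ univ.erase k0, W k / DeltaXir n 0 (shiftr n k s) ≤ 1 / 4 := by
    calc ∑ k ∈ univ.erase k0, W k / DeltaXir n 0 (shiftr n k s) ≤ ∑ k ∈ univ.erase k0, Ur n k s / 4 := by
          refine Finset.sum_le_sum fun k hk => ?_
          have hk' := Finset.ne_of_mem_erase hk
          exact div_le_div₀ (hUnn k) (hWle k hk') (by norm_num) (hDk k hk')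
      _ = (∑ k ∈ univ.erase k0, Ur n k s) / 4 := by rw [Finset.sum_div]
      _ ≤ 1 / 4 := by gcongr
  have h1' : (1 : ℝ) / 4 ≤ (d * Real.pi ^ 2) ^ 2 / (4 * w₀) * T := by
    have hd : (d : ℝ) * Real.pi ^ 2 ≠ 0 := hdpos.ne'
    have hw : w₀ ≠ 0 := hw₀.ne'
    have e : (d * Real.pi ^ 2) ^ 2 / (4 * w₀) * (w₀ / (d * Real.pi ^ 2) ^ 2) = (1 : ℝ) / 4 := by
      rw [div_mul_div_comm, div_eq_div_iff (mul_ne_zero (mul_ne_zero four_ne_zero hw) (pow_ne_zero 2 hd)) four_ne_zero]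
      ring
    rw [← e]
    exact mul_le_mul_of_nonneg_left hTge (by positivity)
  -- (iii) the right-hand side dominates its principal term
  have hR : T ≤ ∑ k : Fin d → Fin n, W k / DeltaXir n 0 (shiftr n k s) ^ 2 := by
    rw [hT, ← hD0]
    exact Finset.single_le_sum (f := fun k => W k / DeltaXir n 0 (shiftr n k s) ^ 2)
      (fun k _ => div_nonneg (hW0 k) (pow_nonneg (hDnn k) 2)) (Finset.mem_univ k0)
  -- assemble
  rw [← Finset.add_sum_erase _ _ (Finset.mem_univ k0)]
  have hC0 : 0 ≤ (d * Real.pi ^ 2 + (d * Real.pi ^ 2) ^ 2 / (4 * w₀) : ℝ) := by positivity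
  calc W k0 / DeltaXir n 0 (shiftr n k0 s) + ∑ k ∈ univ.erase k0, W k / DeltaXir n 0 (shiftr n k s)
      ≤ d * Real.pi ^ 2 * T + (d * Real.pi ^ 2) ^ 2 / (4 * w₀) * T := add_le_add h0 (h1.trans h1')
    _ = (d * Real.pi ^ 2 + (d * Real.pi ^ 2) ^ 2 / (4 * w₀)) * T := by ring
    _ ≤ (d * Real.pi ^ 2 + (d * Real.pi ^ 2) ^ 2 / (4 * w₀))
          * ∑ k : Fin d → Fin n, W k / DeltaXir n 0 (shiftr n k s) ^ 2 := mul_le_mul_of_nonneg_left hR hC0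

/-! ## §2 The box–box–tent weights of the straight symmetric average, and the plain block-mean weights -/

/-- ★★★ **THE ALIAS LEMMA FOR THE BOX–BOX–TENT WEIGHTS** (the straight part of the symmetric (0.4) average in direction `μ`: block mean in all directions times one more 1-D
Dirichlet factor in direction `μ` — the tent = box ∗ segment): with `W_l = |u(p′+l)|²·uFactorr(l_μ; p′_μ)`,
`Σ_l W_l∕Δ(p′+l) ≤ (dπ² + (π²∕4)^{d+1}(dπ²)²∕4)·Σ_l W_l∕Δ(p′+l)²` at every `p′ ≠ 0`, `|p′_μ| ≤ π` — in lattice units the Bernstein inequality `‖∇u‖² ≤ C_Bℓ⁻²‖u‖²` for the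
curl-minimal interpolant `u = Δ⁻¹Sᵀν`, fibre by fibre. [cite: Balaban1984PropagatorsI, (1.31)-(1.36) pp.23-24; Balaban1985Variational, (0.4) p.278] -/
theorem alias_sum_tent_le (hn : 1 ≤ n) (s : Fin d → ℝ) (hs : ∀ μ, |s μ| ≤ Real.pi) (hs0 : s ≠ 0) (μ : Fin d) :
    ∑ k : Fin d → Fin n, Ur n k s * uFactorr n (k μ : ℕ) (s μ) / DeltaXir n 0 (shiftr n k s)
      ≤ (d * Real.pi ^ 2 + (Real.pi ^ 2 / 4) ^ (d + 1) * (d * Real.pi ^ 2) ^ 2 / 4)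
          * ∑ k : Fin d → Fin n, Ur n k s * uFactorr n (k μ : ℕ) (s μ) / DeltaXir n 0 (shiftr n k s) ^ 2 := by
  have hpi : 0 < Real.pi := Real.pi_pos
  have hw₀ : (0 : ℝ) < (4 / Real.pi ^ 2) ^ (d + 1) := by positivity
  have hW0 : ∀ k : Fin d → Fin n, 0 ≤ Ur n k s * uFactorr n (k μ : ℕ) (s μ) := fun k =>
    mul_nonneg (Ur_nonneg n k s) (uFactorr_nonneg n _ _)
  have hWle : ∀ k : Fin d → Fin n, k ≠ (fun _ => (0 : Fin n)) → Ur n k s * uFactorr n (k μ : ℕ) (s μ) ≤ Ur n k s := fun k _ =>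
    mul_le_of_le_one_right (Ur_nonneg n k s) (uFactorr_le_one n hn _ _)
  have hW₀ : (4 / Real.pi ^ 2) ^ (d + 1) ≤ Ur n (fun _ => (0 : Fin n)) s * uFactorr n (((fun _ => (0 : Fin n)) μ : Fin n) : ℕ) (s μ) := by
    rw [pow_succ]
    exact mul_le_mul (Ur_zero_ge n hn s hs) (by simpa using uFactorr_zero_ge n hn (s μ) (hs μ)) (by positivity) (Ur_nonneg n _ s)
  have h := alias_sum_le_of_weights n hn s hs hs0 (fun k => Ur n k s * uFactorr n (k μ : ℕ) (s μ)) hW0 hWle hw₀ hW₀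
  have hC : (d * Real.pi ^ 2 + (d * Real.pi ^ 2) ^ 2 / (4 * (4 / Real.pi ^ 2) ^ (d + 1)) : ℝ)
      = d * Real.pi ^ 2 + (Real.pi ^ 2 / 4) ^ (d + 1) * (d * Real.pi ^ 2) ^ 2 / 4 := by
    have e : (4 / Real.pi ^ 2 : ℝ) ^ (d + 1) = ((Real.pi ^ 2 / 4) ^ (d + 1))⁻¹ := by
      rw [← inv_pow]; congr 1; field_simp
    rw [e]
    field_simp
  rw [hC] at h
  exact h

/-- ★ **THE ALIAS LEMMA FOR THE PLAIN BLOCK-MEAN WEIGHTS** `W_l = |u(p′+l)|²` (Balaban's `Q′` of (1.26)): `Σ_l |u|²∕Δ ≤ (dπ² + (π²∕4)^d(dπ²)²∕4)·Σ_l |u|²∕Δ²` at every `p′ ≠ 0`.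
[cite: Balaban1984PropagatorsI, (1.26) p.22, (1.31)-(1.36) pp.23-24] -/
theorem alias_sum_mean_le (hn : 1 ≤ n) (s : Fin d → ℝ) (hs : ∀ μ, |s μ| ≤ Real.pi) (hs0 : s ≠ 0) :
    ∑ k : Fin d → Fin n, Ur n k s / DeltaXir n 0 (shiftr n k s)
      ≤ (d * Real.pi ^ 2 + (Real.pi ^ 2 / 4) ^ d * (d * Real.pi ^ 2) ^ 2 / 4)
          * ∑ k : Fin d → Fin n, Ur n k s / DeltaXir n 0 (shiftr n k s) ^ 2 := by
  have hpi : 0 < Real.pi := Real.pi_pos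
  have hw₀ : (0 : ℝ) < (4 / Real.pi ^ 2) ^ d := by positivity
  have h := alias_sum_le_of_weights n hn s hs hs0 (fun k => Ur n k s) (fun k => Ur_nonneg n k s) (fun k _ => le_rfl) hw₀
    (Ur_zero_ge n hn s hs)
  have hC : (d * Real.pi ^ 2 + (d * Real.pi ^ 2) ^ 2 / (4 * (4 / Real.pi ^ 2) ^ d) : ℝ)
      = d * Real.pi ^ 2 + (Real.pi ^ 2 / 4) ^ d * (d * Real.pi ^ 2) ^ 2 / 4 := by
    have e : (4 / Real.pi ^ 2 : ℝ) ^ d = ((Real.pi ^ 2 / 4) ^ d)⁻¹ := by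
      rw [← inv_pow]; congr 1; field_simp
    rw [e]
    field_simp
  rw [hC] at h
  exact h

/-! ## §3 Fibre-to-torus: summing the alias inequality over the reduced momenta -/

section Torus

variable (M : Fin d → ℕ) [hM : ∀ μ, NeZero (M μ)]

/-- ★ **FIBRE-TO-TORUS.**  On `T_η = Tor (fine n M)` (`Δ(p) = lsym (fine n M) n p`, η-units `c = n`): a non-negative momentum density `g` that vanishes on the fibre of the zero
reduced momentum and satisfies, on every other fibre, `Σ_l g(p′+l)∕Δ ≤ C·Σ_l g(p′+l)∕Δ²`, satisfies `Σ_p g(p)∕Δ(p) ≤ C·Σ_p g(p)∕Δ(p)²` (✓ `sum_pOf_fibres`). [folklore]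
[cite: Balaban1984PropagatorsI, (1.35) p.24] -/
theorem sum_div_lsym_le_of_fibrewise (g : Tor (fine n M) → ℝ) (C : ℝ)
    (hzero : ∀ k : Fin d → Fin n, g (pOf n M (k, 0)) = 0)
    (hfib : ∀ q : Tor M, q ≠ 0 →
      ∑ k : Fin d → Fin n, g (pOf n M (k, q)) / ‖lsym (fine n M) (n : ℂ) (pOf n M (k, q))‖
        ≤ C * ∑ k : Fin d → Fin n, g (pOf n M (k, q)) / ‖lsym (fine n M) (n : ℂ) (pOf n M (k, q))‖ ^ 2) :
    ∑ p, g p / ‖lsym (fine n M) (n : ℂ) p‖ ≤ C * ∑ p, g p / ‖lsym (fine n M) (n : ℂ) p‖ ^ 2 := by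
  rw [sum_pOf_fibres n M (fun p => g p / ‖lsym (fine n M) (n : ℂ) p‖),
    sum_pOf_fibres n M (fun p => g p / ‖lsym (fine n M) (n : ℂ) p‖ ^ 2),
    ← Finset.add_sum_erase _ _ (Finset.mem_univ (0 : Tor M)),
    ← Finset.add_sum_erase univ (fun q => ∑ k : Fin d → Fin n, g (pOf n M (k, q)) / ‖lsym (fine n M) (n : ℂ) (pOf n M (k, q))‖ ^ 2)
      (Finset.mem_univ (0 : Tor M))]
  have h0a : ∑ k : Fin d → Fin n, g (pOf n M (k, 0)) / ‖lsym (fine n M) (n : ℂ) (pOf n M (k, 0))‖ = 0 :=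
    Finset.sum_eq_zero fun k _ => by rw [hzero k, zero_div]
  have h0b : ∑ k : Fin d → Fin n, g (pOf n M (k, 0)) / ‖lsym (fine n M) (n : ℂ) (pOf n M (k, 0))‖ ^ 2 = 0 :=
    Finset.sum_eq_zero fun k _ => by rw [hzero k, zero_div]
  rw [h0a, h0b, zero_add, zero_add, Finset.mul_sum]
  exact Finset.sum_le_sum fun q hq => hfib q (Finset.ne_of_mem_erase hq)

/-- ★★ **THE BOX–BOX–TENT BERNSTEIN INEQUALITY ON THE TORUS, MOMENTUM FORM.**  If a non-negative momentum density `g` on `T_η = Tor (fine n M)` vanishes on the fibre of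
`p′ = 0` and is, on every fibre `p′ ≠ 0`, a non-negative multiple `c(p′)` of the box–box–tent alias weights `|u(p′+l)|²·uFactorr(l_μ; p′_μ)` (the structure of `|dft(Sᵀν)(p)|²`
for the straight symmetric average in direction `μ`, LOCATE-B1 (C3)), then `Σ_p g(p)∕Δ(p) ≤ C_B·Σ_p g(p)∕Δ(p)²` with `C_B = dπ² + (π²∕4)^{d+1}(dπ²)²∕4` — in lattice units
`⟪f, Δ⁻¹f⟫ ≤ C_B·n⁻²·⟪f, Δ⁻²f⟫` (`Δ_η = n²Δ_lattice`), i.e. `‖∇Δ⁻¹f‖² ≤ C_B n⁻² ‖Δ⁻¹f‖²`. [cite: Balaban1984PropagatorsI, (1.31)-(1.36) pp.23-24; Balaban1985Variational, (0.4) p.278] -/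
theorem sum_div_lsym_le_of_tent_fibres (hn : 1 ≤ n) (μ : Fin d) (g : Tor (fine n M) → ℝ) (c : Tor M → ℝ) (hc : ∀ q, 0 ≤ c q)
    (hzero : ∀ k : Fin d → Fin n, g (pOf n M (k, 0)) = 0)
    (hg : ∀ q : Tor M, q ≠ 0 → ∀ k : Fin d → Fin n,
      g (pOf n M (k, q)) = c q * (Ur n k (sOf M q) * uFactorr n (k μ : ℕ) (sOf M q μ))) :
    ∑ p, g p / ‖lsym (fine n M) (n : ℂ) p‖
      ≤ (d * Real.pi ^ 2 + (Real.pi ^ 2 / 4) ^ (d + 1) * (d * Real.pi ^ 2) ^ 2 / 4) * ∑ p, g p / ‖lsym (fine n M) (n : ℂ) p‖ ^ 2 := by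
  refine sum_div_lsym_le_of_fibrewise n M g _ hzero fun q hq => ?_
  have hs : ∀ ν, |sOf M q ν| ≤ Real.pi := abs_sOf_le M q
  have hs0 : sOf M q ≠ 0 := sOf_ne_zero M hq
  have hnorm : ∀ k : Fin d → Fin n, ‖lsym (fine n M) (n : ℂ) (pOf n M (k, q))‖ = DeltaXir n 0 (shiftr n k (sOf M q)) := fun k => by
    rw [lsym_pOf, Complex.norm_real, Real.norm_of_nonneg (DeltaXir_nonneg n 0 le_rfl _)]
  simp_rw [hnorm, hg q hq]
  have h := alias_sum_tent_le n hn (sOf M q) hs hs0 μ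
  have e1 : ∑ k : Fin d → Fin n, c q * (Ur n k (sOf M q) * uFactorr n (k μ : ℕ) (sOf M q μ)) / DeltaXir n 0 (shiftr n k (sOf M q))
      = c q * ∑ k : Fin d → Fin n, Ur n k (sOf M q) * uFactorr n (k μ : ℕ) (sOf M q μ) / DeltaXir n 0 (shiftr n k (sOf M q)) := by
    rw [Finset.mul_sum]; exact Finset.sum_congr rfl fun k _ => by ring
  have e2 : ∑ k : Fin d → Fin n, c q * (Ur n k (sOf M q) * uFactorr n (k μ : ℕ) (sOf M q μ)) / DeltaXir n 0 (shiftr n k (sOf M q)) ^ 2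
      = c q * ∑ k : Fin d → Fin n, Ur n k (sOf M q) * uFactorr n (k μ : ℕ) (sOf M q μ) / DeltaXir n 0 (shiftr n k (sOf M q)) ^ 2 := by
    rw [Finset.mul_sum]; exact Finset.sum_congr rfl fun k _ => by ring
  rw [e1, e2, mul_left_comm]
  exact mul_le_mul_of_nonneg_left h (hc q)

end Torus


/-! ## §4 ★★★ The flat Bernstein inequality for the adjoint STRAIGHT average (Bałaban's vector average `Q_k` of (1.18)) -/

section Straight

variable (M : Fin d → ℕ) [hM : ∀ μ, NeZero (M μ)]

open B5Adjoint176 in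
/-- ★★★ **BERNSTEIN FOR THE CURL-MINIMAL INTERPOLANT, MOMENTUM FORM.**  On `T_η = Tor (fine n M)` (blocks of side `n ≥ 1`, `Δ(p) = lsym (fine n M) n p`), for Bałaban's
STRAIGHT vector block average `Q_k = B5Block118.QvOp` of (1.18) (= the straight box–box–tent part `S` of the symmetric (0.4) average up to the factor `n` and a translation) and any
coarse vector field `B` whose `κ`-component has zero mean: the fine field `f = ((Q_k)ᴴB)_κ` obeys `Σ_p |f̂(p)|²∕Δ(p) ≤ C_B·Σ_p |f̂(p)|²∕Δ(p)²`, `C_B = dπ² + (π²∕4)^{d+1}(dπ²)²∕4` — by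
✓ `B5Adjoint176.dft_QvOp_adjoint` (`f̂(p′+l) = c·conj(u v_κ)(p′+l)·B̂_κ(p′)`), ✓ `norm_uSym_sq`∕`norm_vSym_sq` (`|u v_κ|² = Ur·uFactorr`) and §3.
[cite: Balaban1984PropagatorsI, (1.18) p.20, (1.31)-(1.36) pp.23-24, (1.76) p.30; Balaban1985Variational, (0.4) p.278] -/
theorem bernstein_QvOp_adjoint (hn : 1 ≤ n) (B : Tor M × Fin d → ℂ) (κ : Fin d) (hB : ∑ y, B (y, κ) = 0) :
    ∑ p, ‖(dft (fine n M) *ᵥ comp (fine n M) ((QvOp n M)ᴴ *ᵥ B) κ) p‖ ^ 2 / ‖lsym (fine n M) (n : ℂ) p‖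
      ≤ (d * Real.pi ^ 2 + (Real.pi ^ 2 / 4) ^ (d + 1) * (d * Real.pi ^ 2) ^ 2 / 4)
          * ∑ p, ‖(dft (fine n M) *ᵥ comp (fine n M) ((QvOp n M)ᴴ *ᵥ B) κ) p‖ ^ 2 / ‖lsym (fine n M) (n : ℂ) p‖ ^ 2 := by
  have hB0 : (dft M *ᵥ comp M B κ) 0 = 0 := by
    rw [dft_zero_apply]
    have : ∑ x, comp M B κ x = 0 := hB
    rw [this, mul_zero]
  refine sum_div_lsym_le_of_tent_fibres n M hn κ (fun p => ‖(dft (fine n M) *ᵥ comp (fine n M) ((QvOp n M)ᴴ *ᵥ B) κ) p‖ ^ 2)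
    (fun q => ‖(cQ n M : ℂ)‖ ^ 2 * ‖(dft M *ᵥ comp M B κ) q‖ ^ 2) (fun q => by positivity) (fun k => ?_) (fun q _ k => ?_)
  · show ‖(dft (fine n M) *ᵥ comp (fine n M) ((QvOp n M)ᴴ *ᵥ B) κ) (pOf n M (k, 0))‖ ^ 2 = 0
    rw [dft_QvOp_adjoint, hB0, mul_zero, norm_zero, zero_pow two_ne_zero]
  · show ‖(dft (fine n M) *ᵥ comp (fine n M) ((QvOp n M)ᴴ *ᵥ B) κ) (pOf n M (k, q))‖ ^ 2
        = ‖(cQ n M : ℂ)‖ ^ 2 * ‖(dft M *ᵥ comp M B κ) q‖ ^ 2 * (Ur n k (sOf M q) * uFactorr n (k κ : ℕ) (sOf M q κ))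
    have hs : ∀ ν, |sOf M q ν| ≤ Real.pi := abs_sOf_le M q
    rw [dft_QvOp_adjoint, norm_mul, norm_mul, mul_pow, mul_pow, Complex.norm_conj, norm_mul, mul_pow,
      norm_uSym_sq n hn k (sOf M q) hs, norm_vSym_sq n hn k (sOf M q) κ (hs κ)]
    ring

/-- ★★★ **BERNSTEIN FOR THE CURL-MINIMAL INTERPOLANT, POSITION FORM** (η-units, `Δ = LapS (fine n M) n`, `Δ⁻¹ = LapSinv`): for `f = ((Q_k)ᴴB)_κ` with `Σ_y B(y,κ) = 0`,
`re⟪f, Δ⁻¹f⟫ ≤ C_B·‖Δ⁻¹f‖²`.  In LATTICE units (`Δ_η = n²Δ_lattice`) this reads `⟪f, Δ_lattice⁻¹f⟫ ≤ C_B·n⁻²·‖Δ_lattice⁻¹f‖²`, i.e. for the interpolant `u := Δ_lattice⁻¹f`: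
`‖∇u‖² ≤ C_B·ℓ⁻²·‖u‖²` (`ℓ = n = L^k`) — the leading-order gauge potential of an R2-critical background is BLOCK-SMOOTH, with an ABSOLUTE constant (numerically the sharp value is
≈ 31.4, ℓ-flat; the mass-minimal preimage instead grows like `8.2·ℓ` — px12 g4 (K3)). [cite: Balaban1984PropagatorsI, (1.18) p.20, Sect. C p.22, (1.35) p.24; Balaban1985Variational, Prop. 7 p.299] -/
theorem bernstein_QvOp_adjoint_pos (hn : 1 ≤ n) (B : Tor M × Fin d → ℂ) (κ : Fin d) (hB : ∑ y, B (y, κ) = 0) :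
    (star (comp (fine n M) ((QvOp n M)ᴴ *ᵥ B) κ) ⬝ᵥ (LapSinv (fine n M) (n : ℂ) *ᵥ comp (fine n M) ((QvOp n M)ᴴ *ᵥ B) κ)).re
      ≤ (d * Real.pi ^ 2 + (Real.pi ^ 2 / 4) ^ (d + 1) * (d * Real.pi ^ 2) ^ 2 / 4)
          * ∑ x, ‖(LapSinv (fine n M) (n : ℂ) *ᵥ comp (fine n M) ((QvOp n M)ᴴ *ᵥ B) κ) x‖ ^ 2 := by
  set f : Tor (fine n M) → ℂ := comp (fine n M) ((QvOp n M)ᴴ *ᵥ B) κ with hf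
  have h := bernstein_QvOp_adjoint n M hn B κ hB
  rw [← Prop7BlockLandauDivFlat.sum_norm_sq_div_lsym_eq n M (n : ℂ) f, ← sum_norm_sq_dft n M (LapSinv (fine n M) (n : ℂ) *ᵥ f)]
  have hR : ∑ p, ‖(dft (fine n M) *ᵥ (LapSinv (fine n M) (n : ℂ) *ᵥ f)) p‖ ^ 2 = ∑ p, ‖(dft (fine n M) *ᵥ f) p‖ ^ 2 / ‖lsym (fine n M) (n : ℂ) p‖ ^ 2 := by
    refine Finset.sum_congr rfl fun p _ => ?_
    rw [dft_LapSinv_apply, norm_mul, mul_pow, norm_inv, inv_pow, div_eq_inv_mul]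
  rw [hR]
  exact h

end Straight

end Summit.QuantumFields.YangMills.Theorems.Prop7AliasSumBernstein

end
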